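import Literature.NumberTheory.Transcendental.TorusScaling
import Literature.NumberTheory.Transcendental.TorusConeBasics
import Mathlib.Analysis.Complex.Polynomial.Basic
import HarnessLib

/-!
# Stabilisers of relevant primes under the torus are subtori `H_B`

Topic: `Literature/NumberTheory/Transcendental` (support for `Philippon1986_zeroEstimate_torus_holds`).
Let `T = (ℂˣ)^d` act on `S = ℂ[X_1, …, X_d]` by the scalings `ρ_g` (`TorusScaling.lean`). For a
prime `𝔭` relevant to the torus (no variable in `𝔭`, i.e. `𝔭 = I(V)` for `V = Z(𝔭) ∩ T`) the set
`H = {g | ρ_g⁻¹ 𝔭 = 𝔭}` of `g` with `g • V = V` is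

* equal to `{g | 𝔭 ⊆ ρ_g⁻¹ 𝔭}` (`comap_scale_eq_iff_le`: both primes have the same dimension), hence
  cut out in `T` by the polynomials `ρ_v f`, `f ∈ 𝔭`, `v ∈ V` (used inside the proof of
  `exists_stabilizer_eq_subtorus`);
* **a subtorus `H_B = ⋂_{a ∈ B} ker χ_a`** for an explicit subgroup `B ≤ ℤ^d` of characters, namely
  `B = {a | χ_a ≡ 1 on H}` (`exists_stabilizer_eq_subtorus`; Nesterenko–Philippon (eds.), LNM 1752,
  Ch. 11 §2.1 Example: "the algebraic subgroups of `G` are the `H_A`").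

The second point is proved for ANY subset `H ⊆ T` containing `1` and closed under multiplication,
and the ideal `J = I(H)` of polynomials vanishing on it: the `B`-ISOTYPIC COMPONENTS of a member of
`J` (monomials `X^m` with `m` in a fixed class modulo `B`) are again in `J`
(`isotypicPart_mem_vanishingIdeal`, by induction on the number of monomials: if `X^{m₁}` is in
another class, some `h ∈ H` has `h^{m₁} ≠ h^{m₀}` and `ρ_h f - h^{m₁} f ∈ J` has fewer monomials and
the same `m₀`-component up to the non-zero factor `h^{m₀} - h^{m₁}`), and an isotypic member of `J`
vanishes wherever the characters trivial on `H` are trivial (`aevalAt_isotypic_eq_zero`); hence every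
polynomial vanishing on `H` vanishes on `H_B ⊇ H` (`aevalAt_eq_zero_of_mem_vanishingIdeal_of_forall_char`),
and the stabiliser, being cut out by such polynomials, is all of `H_B`. No Lie theory and no Haar
measure are used; the only input is elementary character arithmetic on `T`.

## References

* Yu. V. Nesterenko, P. Philippon (eds.), *Introduction to Algebraic Independence Theory*,
  LNM 1752 (2001), Ch. 11 (D. Roy), §2.1, Example (p. 199). [NesterenkoPhilippon2001]
-/

noncomputable section

open MvPolynomial

namespace Literature.NumberTheory.Transcendental

open Torus

variable {d : ℕ}

local notation "ρ[" g "]" =>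
  (MvPolynomial.aeval (R := ℂ) (S₁ := MvPolynomial (Fin d) ℂ)
    (fun i : Fin d => MvPolynomial.C (((g : Fin d → ℂˣ) i : ℂˣ) : ℂ) * MvPolynomial.X i))

/-! ## Characters and monomials -/

/-- The coefficients of `ρ_h f`: `coeff_m (ρ_h f) = χ_m(h) · coeff_m f`. [folklore] -/
theorem coeff_scale_eq_char (h : Torus d) (f : MvPolynomial (Fin d) ℂ) (m : Fin d →₀ ℕ) :
    coeff m (ρ[h] f) = ((char (fun i => (m i : ℤ)) h : ℂˣ) : ℂ) * coeff m f := by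
  rw [coeff_scale, coe_char_natCast]

/-- Difference of exponent classes: `χ_m = χ_{m₀} · χ_{m - m₀}`. [folklore] -/
theorem char_natCast_eq_mul (m m₀ : Fin d →₀ ℕ) (g : Torus d) :
    char (fun i => (m i : ℤ)) g =
      char (fun i => (m₀ i : ℤ)) g * char ((fun i => (m i : ℤ)) - fun i => (m₀ i : ℤ)) g := by
  rw [← MonoidHom.mul_apply]
  have : (fun i => (m i : ℤ)) = (fun i => (m₀ i : ℤ)) + ((fun i => (m i : ℤ)) - fun i => (m₀ i : ℤ)) := by
    abel
  conv_lhs => rw [this]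
  simp only [char_apply, MonoidHom.mul_apply, Pi.add_apply, ← Finset.prod_mul_distrib]
  refine Finset.prod_congr rfl fun i _ => ?_
  rw [zpow_add]

/-! ## Isotypic components of polynomials vanishing on a multiplicative subset of `T` -/

section Isotypic

variable {Hs : Set (Torus d)}

/-- The ideal of polynomials vanishing on `H ⊆ T` is stable under `ρ_h`, `h ∈ H`, when `H` is
closed under multiplication. [folklore] -/
theorem scale_mem_vanishingIdeal (hmul : ∀ g ∈ Hs, ∀ h ∈ Hs, g * h ∈ Hs) {h : Torus d}
    (hh : h ∈ Hs) {f : MvPolynomial (Fin d) ℂ} (hf : f ∈ vanishingIdeal ℂ ((fun (g : Torus d) (i : Fin d) => ((g i : ℂˣ) : ℂ)) '' Hs)) :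
    ρ[h] f ∈ vanishingIdeal ℂ ((fun (g : Torus d) (i : Fin d) => ((g i : ℂˣ) : ℂ)) '' Hs) := by
  rw [mem_vanishingIdeal_iff] at hf ⊢
  rintro _ ⟨g, hg, rfl⟩
  rw [aeval_scale]
  have : h • (fun i => ((g i : ℂˣ) : ℂ)) = fun i => (((h * g) i : ℂˣ) : ℂ) := by
    funext i
    simp [Units.smul_def]
  rw [this]
  exact hf _ ⟨h * g, hmul h hh g hg, rfl⟩

/-- Membership in `I(H)`. [folklore] -/
theorem mem_vanishingIdeal_torus_iff {f : MvPolynomial (Fin d) ℂ} :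
    f ∈ vanishingIdeal ℂ ((fun (g : Torus d) (i : Fin d) => ((g i : ℂˣ) : ℂ)) '' Hs) ↔ ∀ g ∈ Hs, aevalAt f g = 0 := by
  rw [mem_vanishingIdeal_iff]
  constructor
  · intro h g hg
    exact h _ ⟨g, hg, rfl⟩
  · rintro h _ ⟨g, hg, rfl⟩
    exact h g hg

open scoped Classical in
/-- **Isotypic components of members of `I(H)` are in `I(H)`**: for `f ∈ I(H)` and `m₀` a monomial
of `f`, the sum of the monomials `c_m X^m` of `f` with `χ_{m - m₀} ≡ 1` on `H` again vanishes on
`H` (induction on the number of monomials of `f`). [folklore] -/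
theorem isotypicPart_mem_vanishingIdeal (hmul : ∀ g ∈ Hs, ∀ h ∈ Hs, g * h ∈ Hs) :
    ∀ (s : ℕ) (f : MvPolynomial (Fin d) ℂ), f.support.card ≤ s →
      f ∈ vanishingIdeal ℂ ((fun (g : Torus d) (i : Fin d) => ((g i : ℂˣ) : ℂ)) '' Hs) → ∀ m₀ ∈ f.support,
        (∑ m ∈ f.support.filter (fun m => ∀ g ∈ Hs,
            char ((fun i => (m i : ℤ)) - fun i => (m₀ i : ℤ)) g = 1), monomial m (coeff m f)) ∈
          vanishingIdeal ℂ ((fun (g : Torus d) (i : Fin d) => ((g i : ℂˣ) : ℂ)) '' Hs) := by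
  classical
  intro s
  induction s with
  | zero =>
    intro f hf _ m₀ hm₀
    rw [Nat.le_zero, Finset.card_eq_zero] at hf
    rw [hf] at hm₀
    exact absurd hm₀ (Finset.notMem_empty _)
  | succ s ih =>
    intro f hcard hf m₀ hm₀
    by_cases hall : ∀ m ∈ f.support, ∀ g ∈ Hs,
        char ((fun i => (m i : ℤ)) - fun i => (m₀ i : ℤ)) g = 1
    · -- all monomials are in the class of `m₀`: the isotypic part is `f`
      have : f.support.filter (fun m => ∀ g ∈ Hs,
          char ((fun i => (m i : ℤ)) - fun i => (m₀ i : ℤ)) g = 1) = f.support :=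
        Finset.filter_true_of_mem hall
      rw [this, ← f.as_sum]
      exact hf
    push Not at hall
    obtain ⟨m₁, hm₁, h, hh, hne⟩ := hall
    -- `c₀ = χ_{m₀}(h) ≠ χ_{m₁}(h) = c₁`
    set c₀ : ℂ := ((char (fun i => (m₀ i : ℤ)) h : ℂˣ) : ℂ) with hc₀
    set c₁ : ℂ := ((char (fun i => (m₁ i : ℤ)) h : ℂˣ) : ℂ) with hc₁
    have hc : c₀ ≠ c₁ := by
      intro heq
      apply hne
      have h01 : char (fun i => (m₀ i : ℤ)) h = char (fun i => (m₁ i : ℤ)) h := Units.val_injective heq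
      have := char_natCast_eq_mul m₁ m₀ h
      rw [← h01] at this
      exact (mul_eq_left.mp this.symm)
    -- `f'' = ρ_h f - c₁ f ∈ I(H)` has fewer monomials
    set f'' : MvPolynomial (Fin d) ℂ := ρ[h] f - C c₁ * f with hf''
    have hcoeff : ∀ m, coeff m f'' = (((char (fun i => (m i : ℤ)) h : ℂˣ) : ℂ) - c₁) * coeff m f := by
      intro m
      rw [hf'', coeff_sub, coeff_C_mul, coeff_scale_eq_char, sub_mul]
    have hf''mem : f'' ∈ vanishingIdeal ℂ ((fun (g : Torus d) (i : Fin d) => ((g i : ℂˣ) : ℂ)) '' Hs) :=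
      Ideal.sub_mem _ (scale_mem_vanishingIdeal hmul hh hf) (Ideal.mul_mem_left _ _ hf)
    have hsupp : f''.support ⊆ f.support.erase m₁ := by
      intro m hm
      rw [mem_support_iff, hcoeff] at hm
      rw [Finset.mem_erase, mem_support_iff]
      refine ⟨?_, fun h0 => hm (by rw [h0, mul_zero])⟩
      rintro rfl
      exact hm (by rw [← hc₁, sub_self, zero_mul])
    have hcard'' : f''.support.card ≤ s := by
      have := (Finset.card_le_card hsupp).trans_eq (Finset.card_erase_of_mem hm₁)
      omega
    have hm₀'' : m₀ ∈ f''.support := by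
      rw [mem_support_iff, hcoeff, ← hc₀]
      exact mul_ne_zero (sub_ne_zero.mpr hc) (mem_support_iff.mp hm₀)
    have hIH := ih f'' hcard'' hf''mem m₀ hm₀''
    -- the `m₀`-isotypic part of `f''` is `(c₀ - c₁)` times that of `f`
    have hclass : ∀ m, (∀ g ∈ Hs, char ((fun i => (m i : ℤ)) - fun i => (m₀ i : ℤ)) g = 1) →
        coeff m f'' = (c₀ - c₁) * coeff m f := by
      intro m hm
      rw [hcoeff, char_natCast_eq_mul m m₀ h, hm h hh, mul_one]
    have hfilter : f''.support.filter (fun m => ∀ g ∈ Hs,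
          char ((fun i => (m i : ℤ)) - fun i => (m₀ i : ℤ)) g = 1) =
        f.support.filter (fun m => ∀ g ∈ Hs,
          char ((fun i => (m i : ℤ)) - fun i => (m₀ i : ℤ)) g = 1) := by
      ext m
      simp only [Finset.mem_filter, mem_support_iff]
      constructor
      · rintro ⟨hm, hcl⟩
        refine ⟨fun h0 => hm ?_, hcl⟩
        rw [hclass m hcl, h0, mul_zero]
      · rintro ⟨hm, hcl⟩
        refine ⟨?_, hcl⟩
        rw [hclass m hcl]
        exact mul_ne_zero (sub_ne_zero.mpr hc) hm
    have hsum : (∑ m ∈ f''.support.filter (fun m => ∀ g ∈ Hs,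
          char ((fun i => (m i : ℤ)) - fun i => (m₀ i : ℤ)) g = 1), monomial m (coeff m f'')) =
        C (c₀ - c₁) * ∑ m ∈ f.support.filter (fun m => ∀ g ∈ Hs,
          char ((fun i => (m i : ℤ)) - fun i => (m₀ i : ℤ)) g = 1), monomial m (coeff m f) := by
      rw [hfilter, Finset.mul_sum]
      refine Finset.sum_congr rfl fun m hm => ?_
      rw [hclass m (Finset.mem_filter.mp hm).2, C_mul_monomial]
    rw [hsum] at hIH
    have hcinv := Ideal.mul_mem_left _ (C (c₀ - c₁)⁻¹) hIH
    rwa [← mul_assoc, ← map_mul, inv_mul_cancel₀ (sub_ne_zero.mpr hc), map_one, one_mul] at hcinv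

/-- **An isotypic member of `I(H)` vanishes wherever the characters trivial on `H` are trivial**:
if all monomials of `F ∈ I(H)` are in the class of `m₀`, then
`F(z) = χ_{m₀}(z) · F(1) = 0` for every `z` with `χ_a(z) = 1` whenever `χ_a ≡ 1` on `H`.
[folklore] -/
theorem aevalAt_isotypic_eq_zero (h1 : (1 : Torus d) ∈ Hs) {F : MvPolynomial (Fin d) ℂ}
    (hF : F ∈ vanishingIdeal ℂ ((fun (g : Torus d) (i : Fin d) => ((g i : ℂˣ) : ℂ)) '' Hs)) {m₀ : Fin d →₀ ℕ}
    (hclass : ∀ m ∈ F.support, ∀ g ∈ Hs, char ((fun i => (m i : ℤ)) - fun i => (m₀ i : ℤ)) g = 1)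
    {z : Torus d} (hz : ∀ a : Fin d → ℤ, (∀ g ∈ Hs, char a g = 1) → char a z = 1) :
    aevalAt F z = 0 := by
  have hF1 : aevalAt F 1 = 0 := (mem_vanishingIdeal_torus_iff.mp hF) 1 h1
  rw [aevalAt_eq_sum] at hF1 ⊢
  have : ∑ m ∈ F.support, coeff m F * ((char (fun i => (m i : ℤ)) z : ℂˣ) : ℂ) =
      ((char (fun i => (m₀ i : ℤ)) z : ℂˣ) : ℂ) * ∑ m ∈ F.support, coeff m F := by
    rw [Finset.mul_sum]
    refine Finset.sum_congr rfl fun m hm => ?_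
    rw [char_natCast_eq_mul m m₀ z, hz _ (hclass m hm), mul_one, mul_comm]
  rw [this]
  have h1' : ∑ m ∈ F.support, coeff m F = 0 := by
    simpa [map_one] using hF1
  rw [h1', mul_zero]

/-- **Every polynomial vanishing on `H` vanishes on `H_B`, `B = {a | χ_a ≡ 1 on H}`** (for
`H ∋ 1` closed under multiplication): split off an isotypic component and induct on the number of
monomials. [folklore] -/
theorem aevalAt_eq_zero_of_mem_vanishingIdeal_of_forall_char (h1 : (1 : Torus d) ∈ Hs)
    (hmul : ∀ g ∈ Hs, ∀ h ∈ Hs, g * h ∈ Hs) {z : Torus d}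
    (hz : ∀ a : Fin d → ℤ, (∀ g ∈ Hs, char a g = 1) → char a z = 1) :
    ∀ (s : ℕ) (f : MvPolynomial (Fin d) ℂ), f.support.card ≤ s →
      f ∈ vanishingIdeal ℂ ((fun (g : Torus d) (i : Fin d) => ((g i : ℂˣ) : ℂ)) '' Hs) → aevalAt f z = 0 := by
  classical
  intro s
  induction s with
  | zero =>
    intro f hf _
    rw [Nat.le_zero, Finset.card_eq_zero, support_eq_empty] at hf
    rw [hf, aevalAt_eq_aeval, map_zero]
  | succ s ih =>
    intro f hcard hf
    rcases f.support.eq_empty_or_nonempty with he | ⟨m₀, hm₀⟩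
    · rw [support_eq_empty] at he; rw [he, aevalAt_eq_aeval, map_zero]
    set F := ∑ m ∈ f.support.filter (fun m => ∀ g ∈ Hs,
        char ((fun i => (m i : ℤ)) - fun i => (m₀ i : ℤ)) g = 1), monomial m (coeff m f) with hFdef
    have hFmem := isotypicPart_mem_vanishingIdeal hmul (s + 1) f hcard hf m₀ hm₀
    rw [← hFdef] at hFmem
    have hcoeffF : ∀ m, coeff m F = if (m ∈ f.support ∧ ∀ g ∈ Hs,
        char ((fun i => (m i : ℤ)) - fun i => (m₀ i : ℤ)) g = 1) then coeff m f else 0 := by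
      intro m
      rw [hFdef, coeff_sum]
      simp only [coeff_monomial]
      rw [Finset.sum_ite_eq']
      simp only [Finset.mem_filter]
    have hFsupp : ∀ m ∈ F.support, ∀ g ∈ Hs,
        char ((fun i => (m i : ℤ)) - fun i => (m₀ i : ℤ)) g = 1 := by
      intro m hm
      rw [mem_support_iff, hcoeffF] at hm
      split_ifs at hm with hcond
      · exact hcond.2
      · exact absurd rfl hm
    have hFz : aevalAt F z = 0 := aevalAt_isotypic_eq_zero h1 hFmem hFsupp hz
    -- `f - F` has fewer monomials (the class of `m₀` is gone)
    have hsupp : (f - F).support ⊆ f.support.erase m₀ := by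
      intro m hm
      rw [mem_support_iff, coeff_sub, hcoeffF] at hm
      rw [Finset.mem_erase, mem_support_iff]
      split_ifs at hm with hcond
      · exact absurd (sub_self _) hm
      · refine ⟨?_, fun h0 => hm (by rw [h0, sub_zero])⟩
        rintro rfl
        apply hcond
        refine ⟨hm₀, fun g _ => ?_⟩
        rw [sub_self]
        simp [char_apply]
    have hcard' : (f - F).support.card ≤ s := by
      have := (Finset.card_le_card hsupp).trans_eq (Finset.card_erase_of_mem hm₀)
      omega
    have hdiff := ih (f - F) hcard' (Ideal.sub_mem _ hf hFmem)
    rw [aevalAt_eq_aeval, map_sub, ← aevalAt_eq_aeval, ← aevalAt_eq_aeval, hFz, sub_zero] at hdiff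
    exact hdiff

end Isotypic

/-! ## Stabilisers of relevant primes -/

/-- For a prime `𝔭` the inclusion `𝔭 ⊆ ρ_g⁻¹ 𝔭` is already equality (both are primes of the same
finite dimension). [folklore] -/
theorem comap_scale_eq_iff_le {𝔭 : Ideal (MvPolynomial (Fin d) ℂ)} [𝔭.IsPrime] (g : Torus d) :
    𝔭.comap ρ[g] = 𝔭 ↔ 𝔭 ≤ 𝔭.comap ρ[g] := by
  constructor
  · intro h; exact h.ge
  · intro hle
    obtain ⟨n, hn, -⟩ := Literature.RingTheory.MvPolynomial.exists_nat_ringKrullDim_quotient_eq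
      (K := ℂ) (‹𝔭.IsPrime›).ne_top
    have hcomap : ringKrullDim (MvPolynomial (Fin d) ℂ ⧸ 𝔭.comap ρ[g]) = n := by
      rw [ringKrullDim_quotient_comap_scale, hn]
    haveI : (𝔭.comap ρ[g]).IsPrime := Ideal.comap_isPrime _ _
    exact (Literature.RingTheory.MvPolynomial.eq_of_le_of_ringKrullDim_quotient_eq hle hn hcomap).symm

/-- Lifting a torus point of `ℂ^d` to `T`. [folklore] -/
theorem exists_torus_eq {v : Fin d → ℂ} (hv : ∀ i, v i ≠ 0) :
    ∃ v' : Torus d, (fun i => ((v' i : ℂˣ) : ℂ)) = v :=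
  ⟨fun i => Units.mk0 (v i) (hv i), funext fun _ => rfl⟩

/-- `z • v' = v' • z` on coordinates. [folklore] -/
theorem smul_torus_comm (z v' : Torus d) :
    z • (fun i => ((v' i : ℂˣ) : ℂ)) = v' • (fun i => ((z i : ℂˣ) : ℂ)) := by
  funext i
  simp [Units.smul_def, mul_comm]

/-- **The stabiliser of a relevant prime is a subtorus `H_B`** (LNM 1752 Ch. 11 §2.1 Example: the
algebraic subgroups of `𝔾ₘ^d` are the `H_A`): for a prime `𝔭 ⊆ ℂ[X_1, …, X_d]` containing no
variable there is a subgroup `B ≤ ℤ^d` with `{g ∈ T | ρ_g⁻¹ 𝔭 = 𝔭} = H_B`; explicitly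
`B = {a | χ_a(g) = 1 whenever ρ_g⁻¹ 𝔭 = 𝔭}`.
[cite: NesterenkoPhilippon2001, Ch. 11 §2.1 Example p. 199] -/
theorem exists_stabilizer_eq_subtorus {𝔭 : Ideal (MvPolynomial (Fin d) ℂ)} [𝔭.IsPrime]
    (hrel : ∀ i, (X i : MvPolynomial (Fin d) ℂ) ∉ 𝔭) :
    ∃ B : AddSubgroup (Fin d → ℤ), ∀ g : Torus d, 𝔭.comap ρ[g] = 𝔭 ↔ g ∈ subtorus B := by
  classical
  -- the stabiliser as a multiplicative subset
  set Hs : Set (Torus d) := {g | 𝔭 ≤ 𝔭.comap ρ[g]} with hHs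
  have hmemHs : ∀ g, g ∈ Hs ↔ ∀ f ∈ 𝔭, ρ[g] f ∈ 𝔭 := fun g => Iff.rfl
  have h1 : (1 : Torus d) ∈ Hs := by
    rw [hmemHs]; intro f hf; rwa [scale_one]
  have hmul : ∀ g ∈ Hs, ∀ h ∈ Hs, g * h ∈ Hs := by
    intro g hg h hh
    rw [hmemHs] at hg hh ⊢
    intro f hf
    rw [← scale_scale]
    exact hg _ (hh f hf)
  -- the characters trivial on it
  have hchar_add : ∀ (a b : Fin d → ℤ) (g : Torus d), char (a + b) g = char a g * char b g := by
    intro a b g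
    simp only [char_apply, Pi.add_apply, zpow_add, Finset.prod_mul_distrib]
  have hchar_zero : ∀ g : Torus d, char (0 : Fin d → ℤ) g = 1 := fun g => by simp [char_apply]
  have hchar_neg : ∀ (a : Fin d → ℤ) (g : Torus d), char (-a) g = (char a g)⁻¹ := by
    intro a g
    simp only [char_apply, Pi.neg_apply, zpow_neg, Finset.prod_inv_distrib]
  let B : AddSubgroup (Fin d → ℤ) :=
    { carrier := {a | ∀ g ∈ Hs, char a g = 1}
      zero_mem' := fun g _ => hchar_zero g
      add_mem' := fun {a b} ha hb g hg => by rw [hchar_add, ha g hg, hb g hg, one_mul]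
      neg_mem' := fun {a} ha g hg => by rw [hchar_neg, ha g hg, inv_one] }
  have hmemB : ∀ a, a ∈ B ↔ ∀ g ∈ Hs, char a g = 1 := fun a => Iff.rfl
  refine ⟨B, fun z => ?_⟩
  rw [comap_scale_eq_iff_le, mem_subtorus]
  change z ∈ Hs ↔ _
  constructor
  · intro hz a ha
    exact (hmemB a).mp ha z hz
  · intro hz
    have hz' : ∀ a : Fin d → ℤ, (∀ g ∈ Hs, char a g = 1) → char a z = 1 :=
      fun a ha => hz a ((hmemB a).mpr ha)
    rw [hmemHs]
    intro f hf
    rw [← vanishingIdeal_zeroLocus_inter_torus hrel, mem_vanishingIdeal_iff]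
    rintro v ⟨hv𝔭, hvU⟩
    obtain ⟨v', rfl⟩ := exists_torus_eq hvU
    rw [aeval_scale, smul_torus_comm, ← aeval_scale]
    -- `ρ_{v'} f` vanishes on the stabiliser
    have hq : ρ[v'] f ∈ vanishingIdeal ℂ ((fun (g : Torus d) (i : Fin d) => ((g i : ℂˣ) : ℂ)) '' Hs) := by
      rw [mem_vanishingIdeal_torus_iff]
      intro g hg
      rw [aevalAt_eq_aeval, aeval_scale, ← smul_torus_comm, ← aeval_scale]
      exact (mem_zeroLocus_iff.mp hv𝔭) _ ((hmemHs g).mp hg f hf)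
    exact aevalAt_eq_zero_of_mem_vanishingIdeal_of_forall_char h1 hmul hz' _ _ le_rfl hq

end Literature.NumberTheory.Transcendental

end
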